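import Summits.BirchSwinnertonDyer.BirchSwinnertonDyer.Theses.CMKolyvaginAtInertTwo
import Summits.BirchSwinnertonDyer.BirchSwinnertonDyer.Theorems.CMKolyvaginAtInertTwoCMPrimitiveSupplyAtInertTwoOfKolyvaginConjecture
import HarnessLib

/-! Scratch (bsd-line-cmk2-p1 g3): kernel check of the TURNKEY route edit for crux #2
`CMPrimitiveSupplyAtInertTwo` (stmt-BirchSwinnertonDyer-24276) — the 22837 → 24154 pattern:
(a) NEW crux `CMKolyvaginConjectureAtInertTwo` (= Kolyvagin's conjecture at `p = 2` on H₂, in the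
    binders of 24276; replaces 24276 as the route's supply crux — 24276 becomes an aside);
(b) NEW support twin `CMPrimitiveSupplyAtInertTwoOfFacts` (closable BY NAME, closer below);
(c) NEW cite-level support items `ModularityExistsNewform` (= `exists_isNewformOf`, BCDT 2001)
    and `HoffsteinLuoTwist` (= `HoffsteinLuo1997_exists_twist_L_one_ne_zero`); the route's
    `GrossZagierAllLevels` (24148) is reused;
(d) the re-pointed `closes'` (eleven binders, all used);
(e) the one-line closer of (b) = p594599's
    `Theorems.CMSupply.cmPrimitiveSupplyAtInertTwo_of_kolyvaginConjectureAtTwo`.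
Optional tenure pass (p594125 `KolyvaginFrobeniusTwo.not_isSquare_and_of_cmInert_two_of_heegner`):
the two `¬ IsSquare` conjuncts of 24276 / binders of 24277 are redundant on H₂ and may be dropped.
BSD is not proved by any of this. -/

namespace Scratch.CMKolyvaginAtInertTwoEdit24276

open Summit.BirchSwinnertonDyer.BirchSwinnertonDyer.Theses.CMKolyvaginAtInertTwo
open Literature.NumberTheory.EllipticCurves Literature.NumberTheory.EllipticCurves.ModularForms

/-- (a) NEW crux: Kolyvagin's conjecture at `p = 2` on the habitat H₂ (CM, `2` inert in `F`):
for every member of H₂, every admissible Heegner field and every optimal odd-Manin frame with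
`y_K = P(1)` of infinite order, some square-free product `n` of Zhang-Kolyvagin primes at `2`
inert in `F` has `P(n) ∉ 2E(K[n])`. -/
def CMKolyvaginConjectureAtInertTwo : Prop :=
  ∀ (W : WeierstrassCurve ℚ) [W.IsElliptic] [W.IsGloballyMinimal] [NeZero (W.conductorNorm ℤ)],
    W.HasCM → Literature.NumberTheory.EllipticCurves.Rank1Residual.CMInert W 2 →
    W.HasSurjectiveModNGaloisRep (2 : ℤ) → W.analyticRank = 1 → Odd W.tamagawaProduct →
    ∀ (K : Type) [Field K] [NumberField K], IsImaginaryQuadratic K → Odd (NumberField.discr K) →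
    NumberField.discr K ≠ -3 → SatisfiesHeegnerHypothesis (W.conductorNorm ℤ) K →
    ∀ (Dt : ModularParametrizationData W (W.conductorNorm ℤ)),
    (∀ z ∈ Dt.L.lattice, ∃ w ∈ periodLattice Dt.f, z = (Dt.c : ℂ) * w) → Odd Dt.c →
    ∀ (β : ℤ) (ι : K →+* ℂ) (d₁ : KolyvaginHeegnerData Dt β ι 1), ¬ IsOfFinAddOrder d₁.derivedPoint →
    ∃ (n : ℕ) (d : KolyvaginHeegnerData Dt β ι n), Squarefree n ∧
      (∀ ℓ ∈ n.primeFactors, (Zhang2014.IsKolyvaginPrime (W.conductorNorm ℤ) W K 2 ℓ ∧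
        Literature.NumberTheory.EllipticCurves.Rank1Residual.CMInert W ℓ)) ∧
      ¬ ∃ Q : (W.baseChange (ringClassField K ι n)).toAffine.Point, (2 : ℤ) • Q = d.derivedPoint

/-- (c) NEW support item (cite-level, by name): modularity, existence of the newform (BCDT 2001). -/
def ModularityExistsNewform : Prop := exists_isNewformOf

/-- (c) NEW support item (cite-level, by name): Hoffstein–Luo 1997 non-vanishing twist. -/
def HoffsteinLuoTwist : Prop := HoffsteinLuo1997_exists_twist_L_one_ne_zero

/-- (b) NEW support twin of 24276 with its published inputs and the new crux as antecedents. -/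
def CMPrimitiveSupplyAtInertTwoOfFacts : Prop :=
  (exists_isNewformOf ∧ HoffsteinLuo1997_exists_twist_L_one_ne_zero ∧
    (∀ (N : ℕ) [NeZero N] (W : WeierstrassCurve ℚ) (K : Type) [Field K] [NumberField K],
      gross_zagier N W K)) →
  CMKolyvaginConjectureAtInertTwo → CMPrimitiveSupplyAtInertTwo

/-- (d) The re-pointed deciding theorem: all eleven binders used. -/
theorem closes' (hKC : CMKolyvaginConjectureAtInertTwo) (hPf : CMPrimitiveSupplyAtInertTwoOfFacts)
    (hX : CMKolyvaginExactAtInertTwo) (hGf : CMExactDescentAtTwoOfFacts) (hR : OffHabitatCMResidualAtTwo)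
    (hBF : CMRankZeroBSDTriple) (hL : EntireLFunctionRat) (hGZ : GrossZagierAllLevels)
    (hGZK : MultPublishedInputsAtTwo) (hMi : MilneAnyModel) (hmod : ModularityExistsNewform)
    (hHL : HoffsteinLuoTwist) : Summit.BirchSwinnertonDyer.WAllCornerFTwo :=
  closes (hPf ⟨hmod, hHL, hGZ⟩ hKC) hX hGf hR hBF hL hGZ hGZK hMi

/-- (e) The closer of the twin, already in the tree (p594599). -/
theorem cmPrimitiveSupplyAtInertTwoOfFacts_proof : CMPrimitiveSupplyAtInertTwoOfFacts :=
  fun h hKC ↦ Summit.BirchSwinnertonDyer.BirchSwinnertonDyer.Theorems.CMSupply.cmPrimitiveSupplyAtInertTwo_of_kolyvaginConjectureAtTwo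
    h.1 h.2.1 h.2.2 hKC

end Scratch.CMKolyvaginAtInertTwoEdit24276
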